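import Literature.AlgebraicGeometry.Resolution.ValuationExtensionsConjugate
import Mathlib.FieldTheory.Extension
import Mathlib.FieldTheory.Normal.Basic
import Mathlib.FieldTheory.Galois.Basic
import HarnessLib

/-!
# Conjugacy of the extensions of a valuation ring to an arbitrary Galois extension

Topic: `Literature/AlgebraicGeometry/Resolution` (valuation theory; third file of the proof of
the named fact `KuhlmannNovacoski2014_Thm12`). The conjugation theorem of
`ValuationExtensionsConjugate.lean` (finite Galois extensions) is extended to arbitrary, possibly
infinite, Galois extensions `E|F`:

* `ValuationSubring.exists_smul_eq_of_comap_eq_of_isGalois` — for `E|F` Galois and valuation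
  rings `W, W'` of `E` with `W ∩ F = W' ∩ F` there is `σ ∈ Gal(E|F)` with `σ(W) = W'`
  (Endler, *Valuation theory*, (14.1)/(14.4); Engler–Prestel, *Valued fields*, Thm. 3.2.15;
  Kuhlmann 2010 §1.1: "all extensions of the valuation `v` from `K` to `K^{sep}` are
  conjugate").

Proof by Zorn's lemma on Mathlib's partial lifts `IntermediateField.Lifts F E E`, restricted to
the lifts `(M, ι)` with `M|F` normal and `ι` transporting `W ∩ M` into `W'`
(`z ∈ W ↔ ι z ∈ W'`): chains have unions; a maximal such lift with `M ≠ E` extends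
(`ValuationSubring.exists_lift_ge_of_isGalois`) — take `s ∉ M`, the finite Galois extension
`N = M(roots of the minimal polynomial of s over F)` of `M` (normal over `F`), any extension
`θ ∈ Gal(E|F)` of `ι`; the valuation rings `W ∩ N` and `θ⁻¹(W') ∩ N` agree on `M`, so by the
finite conjugation theorem over `M` they differ by some `ρ ∈ Gal(N|M)`, and `θ ∘ ρ` is a good
lift on `N` — so `M = E`, and `ι ∈ Gal(E|F)` conjugates `W` to `W'`.

All statements [folklore]; nothing is defined.
-/

noncomputable section

open scoped Pointwise
open IntermediateField Polynomial

namespace Literature.AlgebraicGeometry.Resolution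

namespace ValuationSubring

variable {F E : Type*} [Field F] [Field E] [Algebra F E]

/-- **The extension step.** For `E|F` Galois, a partial lift `ι : M → E` on an intermediate
field `M` normal over `F` which transports `W ∩ M` into `W'` (`z ∈ W ↔ ι z ∈ W'`) extends, for
every `s ∈ E`, to such a lift on an intermediate field normal over `F` containing `M` and `s`.
[folklore] -/
theorem exists_lift_ge_of_isGalois [IsGalois F E] (W W' : _root_.ValuationSubring E)
    (x : Lifts F E E) [hxN : Normal F x.carrier]
    (hx : ∀ z : x.carrier, ((z : E) ∈ W ↔ x.emb z ∈ W')) (s : E) :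
    ∃ y : Lifts F E E, x ≤ y ∧ s ∈ y.carrier ∧ Normal F y.carrier ∧
      ∀ z : y.carrier, ((z : E) ∈ W ↔ y.emb z ∈ W') := by
  classical
  set M : IntermediateField F E := x.carrier with hM
  have hint : ∀ t : E, IsIntegral F t := fun t => Algebra.IsIntegral.isIntegral t
  -- `N' = M(roots of the minimal polynomial of s)`, a finite Galois extension of `M`
  set p : Polynomial M := (minpoly F s).map (algebraMap F M) with hp
  have hsplits : (p.map (algebraMap M E)).Splits := by
    rw [hp, Polynomial.map_map, ← IsScalarTower.algebraMap_eq]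
    exact Normal.splits inferInstance s
  have hrs : p.rootSet E = (minpoly F s).rootSet E := by
    ext t
    rw [hp, Polynomial.mem_rootSet, Polynomial.mem_rootSet, Polynomial.aeval_map_algebraMap,
      Polynomial.map_ne_zero_iff (algebraMap F M).injective]
  have hsS : s ∈ p.rootSet E := by
    rw [hrs, Polynomial.mem_rootSet]
    exact ⟨minpoly.ne_zero (hint s), minpoly.aeval F s⟩
  haveI : Finite (p.rootSet E) := (Polynomial.rootSet_finite _ _).to_subtype
  set N' : IntermediateField M E := IntermediateField.adjoin M (p.rootSet E) with hN'
  haveI : FiniteDimensional M N' :=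
    IntermediateField.finiteDimensional_adjoin fun t _ => (hint t).tower_top
  haveI : IsSplittingField M N' p := IntermediateField.adjoin_rootSet_isSplittingField hsplits
  haveI : Normal M N' := Normal.of_isSplittingField p
  haveI : Algebra.IsSeparable M E := Algebra.isSeparable_tower_top_of_isSeparable F M E
  haveI : Algebra.IsSeparable M N' := Algebra.isSeparable_tower_bot_of_isSeparable M N' E
  haveI : IsGalois M N' := isGalois_iff.mpr ⟨inferInstance, inferInstance⟩
  -- extend `x.emb` to `θ ∈ Gal(E|F)`
  obtain ⟨θ, hθ⟩ := IntermediateField.exists_algHom_of_splits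
    (fun t => ⟨hint t, Normal.splits inferInstance t⟩) x.emb
  have hθM : ∀ z : M, θ z = x.emb z := fun z => by
    rw [← hθ]
    rfl
  set θ' : E ≃ₐ[F] E := AlgEquiv.ofBijective θ (Algebra.IsAlgebraic.algHom_bijective θ) with hθ'
  have hθ'apply : ∀ z : E, θ' z = θ z := fun z => rfl
  -- `W₂ := θ⁻¹(W')` agrees with `W` on `M`
  set W₂ : _root_.ValuationSubring E := θ'.symm • W' with hW₂
  have hW₂mem : ∀ z : E, z ∈ W₂ ↔ θ z ∈ W' := fun z => by
    rw [hW₂, mem_smul_iff, AlgEquiv.symm_symm, hθ'apply]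
  have hagree : ∀ z : M, (z : E) ∈ W ↔ (z : E) ∈ W₂ := fun z => by
    rw [hW₂mem, hθM, hx]
  -- the traces on `N'` lie over the same valuation ring of `M`
  set WN : _root_.ValuationSubring N' := W.comap (algebraMap N' E) with hWN
  set W₂N : _root_.ValuationSubring N' := W₂.comap (algebraMap N' E) with hW₂N
  have hcomap : WN.comap (algebraMap M N') = W₂N.comap (algebraMap M N') := by
    ext z
    change algebraMap N' E (algebraMap M N' z) ∈ W ↔ algebraMap N' E (algebraMap M N' z) ∈ W₂
    rw [← IsScalarTower.algebraMap_apply]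
    exact hagree z
  -- finite conjugation over `M`
  obtain ⟨ρ, hρ⟩ := exists_smul_eq_of_comap_eq WN W₂N hcomap
  -- the new lift `θ ∘ ρ` on `N = N'` viewed over `F`
  let emb' : N'.restrictScalars F →ₐ[F] E :=
    θ'.toAlgHom.comp ((N'.val.restrictScalars F).comp (ρ.toAlgHom.restrictScalars F))
  have hemb' : ∀ z : N', emb' z = θ ((ρ z : N') : E) := fun z => rfl
  have hMN : M ≤ N'.restrictScalars F := fun z hz => IntermediateField.algebraMap_mem N' ⟨z, hz⟩
  refine ⟨⟨N'.restrictScalars F, emb'⟩, ⟨hMN, fun z => ?_⟩, IntermediateField.subset_adjoin M _ hsS,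
    ?_, fun z => ?_⟩
  · -- compatibility with `x.emb`
    have hincl : (IntermediateField.inclusion hMN z : N') = algebraMap M N' z := Subtype.ext rfl
    change emb' (IntermediateField.inclusion hMN z) = x.emb z
    rw [hemb', hincl, AlgEquiv.commutes]
    exact hθM z
  · -- `N` is normal over `F`: `N = M ⊔ F(roots)`
    have hN : N'.restrictScalars F = M ⊔ IntermediateField.adjoin F ((minpoly F s).rootSet E) := by
      rw [hN', IntermediateField.restrictScalars_adjoin_eq_sup, hrs]
    haveI : Normal F (IntermediateField.adjoin F ((minpoly F s).rootSet E)) := by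
      haveI := IntermediateField.adjoin_rootSet_isSplittingField
        (Normal.splits (inferInstance : Normal F E) s)
      exact Normal.of_isSplittingField (minpoly F s)
    change Normal F (N'.restrictScalars F)
    rw [hN]
    infer_instance
  · -- transport of `W ∩ N` into `W'`
    change (z : E) ∈ W ↔ emb' z ∈ W'
    rw [hemb', ← hW₂mem]
    change z ∈ WN ↔ ρ z ∈ W₂N
    rw [← hρ, mem_smul_iff, AlgEquiv.symm_apply_apply]
    exact Iff.rfl

/-- **Conjugation theorem for arbitrary Galois extensions** (Endler (14.1), (14.4);
Engler–Prestel Thm. 3.2.15): for `E|F` Galois, valuation rings of `E` lying over the same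
valuation ring of `F` are conjugate under `Gal(E|F)`. [folklore] -/
theorem exists_smul_eq_of_comap_eq_of_isGalois [IsGalois F E]
    (W W' : _root_.ValuationSubring E)
    (hO : W.comap (algebraMap F E) = W'.comap (algebraMap F E)) :
    ∃ σ : E ≃ₐ[F] E, σ • W = W' := by
  classical
  let good : Set (Lifts F E E) :=
    {x | ∃ _ : Normal F x.carrier, ∀ z : x.carrier, ((z : E) ∈ W ↔ x.emb z ∈ W')}
  -- the bottom lift is good
  have hbot : (⊥ : Lifts F E E) ∈ good := by
    refine ⟨?_, fun z => ?_⟩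
    · change Normal F (⊥ : IntermediateField F E)
      infer_instance
    · obtain ⟨b, hb⟩ := IntermediateField.mem_bot.mp z.2
      have hz : z = algebraMap F (⊥ : Lifts F E E).carrier b :=
        Subtype.ext (by rw [← hb]; rfl)
      rw [hz, AlgHom.commutes]
      change algebraMap F E b ∈ W ↔ algebraMap F E b ∈ W'
      exact SetLike.ext_iff.mp hO b
  -- chains of good lifts have good upper bounds
  have hchain : ∀ c ⊆ good, IsChain (· ≤ ·) c → ∀ y ∈ c, ∃ ub ∈ good, ∀ z ∈ c, z ≤ ub := by
    intro c hcg hc y hy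
    refine ⟨Lifts.union c hc, ⟨?_, fun z => ?_⟩, fun z hz => Lifts.le_union c hc hz⟩
    · haveI : ∀ i : c, Normal F i.1.carrier := fun i => (hcg i.2).1
      rw [Lifts.carrier_union]
      infer_instance
    · haveI : Nonempty c := ⟨⟨y, hy⟩⟩
      have dir : Directed (· ≤ ·) fun i : c => i.1.carrier :=
        hc.directedOn.directed_val.mono_comp _ fun _ _ h => h.1
      have hz : (z : E) ∈ ((⨆ i : c, i.1.carrier : IntermediateField F E) : Set E) := by
        rw [← Lifts.carrier_union c hc]
        exact z.2
      rw [IntermediateField.coe_iSup_of_directed dir, Set.mem_iUnion] at hz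
      obtain ⟨i, hi⟩ := hz
      obtain ⟨hle, hcompat⟩ := Lifts.le_union c hc i.2
      have heq : (Lifts.union c hc).emb z = i.1.emb ⟨z, hi⟩ := by
        rw [← hcompat ⟨z, hi⟩]
        rfl
      rw [heq]
      exact (hcg i.2).2 ⟨z, hi⟩
  obtain ⟨m, -, hm⟩ := zorn_le_nonempty₀ good hchain ⊥ hbot
  obtain ⟨hmN, hmgood⟩ := hm.prop
  -- a maximal good lift is defined on all of `E`
  have htop : m.carrier = ⊤ := by
    by_contra hne
    obtain ⟨s, hs⟩ : ∃ s : E, s ∉ m.carrier := by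
      by_contra h
      push Not at h
      exact hne (eq_top_iff.mpr fun s _ => h s)
    haveI := hmN
    obtain ⟨y, hmy, hsy, hyN, hygood⟩ := exists_lift_ge_of_isGalois W W' m hmgood s
    have hym : y ≤ m := hm.le_of_ge ⟨hyN, hygood⟩ hmy
    exact hs (hym.1 hsy)
  -- the automorphism
  let e : E ≃ₐ[F] m.carrier :=
    ((IntermediateField.equivOfEq htop).trans IntermediateField.topEquiv).symm
  have he : ∀ z : E, ((e z : m.carrier) : E) = z := fun z => rfl
  let σ₀ : E →ₐ[F] E := m.emb.comp e.toAlgHom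
  have hσ₀ : ∀ z : E, σ₀ z = m.emb (e z) := fun z => rfl
  let σ : E ≃ₐ[F] E := AlgEquiv.ofBijective σ₀ (Algebra.IsAlgebraic.algHom_bijective σ₀)
  have hσ : ∀ z : E, σ z = m.emb (e z) := fun z => rfl
  have key : ∀ z : E, z ∈ W ↔ σ z ∈ W' := fun z => by
    have h := hmgood (e z)
    rwa [he z] at h
  refine ⟨σ, ?_⟩
  ext z
  rw [mem_smul_iff, key, AlgEquiv.apply_symm_apply]

end ValuationSubring

end Literature.AlgebraicGeometry.Resolution

end
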